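import Summits.HodgeConjecture.HodgeConjecture.Theorems.PeriodDeficiencyQbarGenericIsHodgeGenericStubMtRankHodgeEqOfIso
import Summits.HodgeConjecture.HodgeConjecture.Theorems.PeriodDeficiencyQbarGenericIsHodgeGenericTensorComparisonTransport
import Literature.AlgebraicGeometry.Motives.BaseChangeProofs
import HarnessLib

/-!
# Route PeriodDeficiency — `QbarGenericIsHodgeGeneric` (stmt-HodgeConjecture-11595), line `registered`: stub `stub_conjugateComparison_of_nonempty_iso` (S3 of reshape r6)

The registered stub `stub_conjugateComparison_of_nonempty_iso` (S3 of reshape r6) of the line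
skeleton `Cruxes/QbarGenericIsHodgeGeneric/Lines/birth.lean`, proved UNCONDITIONALLY. It is the
boundary case `X^τ ≅ X` of the open stub S1 `stub_conjugateComparison_hodgeTensors`.

**Statement.** Let `B` be a Betti–Hodge realization datum over `ℂ`, `τ ∈ Aut(ℂ)`, `X` a smooth
projective `ℂ`-variety with conjugate `X^τ = conjugateVariety τ X`, and `i` a degree, with
`Hⁱ(X)`, `Hⁱ(X^τ)` finite dimensional. If `X^τ ≅ X` as `ℂ`-schemes, there is a `ℂ`-LINEAR
isomorphism `ψ : ℂ ⊗ Hⁱ(X) ≃ ℂ ⊗ Hⁱ(X^τ)` whose tensor functoriality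
`T ψ = ψ^{⊗a} ⊗ ((ψ⁻¹)ᵀ)^{⊗b}` carries, for every `(a, b)` with `(a - b) i = 0`, the `ℂ`-span of
the comparison images `𝒞(1 ⊗ t)` of the weight-`0` Hodge tensors `t ∈ T^{a,b} Hⁱ(X)` onto the
corresponding span for `Hⁱ(X^τ)`; here
`𝒞 = (piTensorBaseChange ⊗ ((dualBaseChange)^{⊗b} ∘ piTensorBaseChange)) ∘ tensorBaseChange :
ℂ ⊗ T^{a,b} V → (ℂ ⊗ V)^{⊗a} ⊗ ((ℂ ⊗ V)^∨)^{⊗b}` is the composite of the tree's comparison maps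
(`Motives/HodgeTensor.lean`).

**Proof** (Voisin I, §7.3.2: pull-backs along isomorphisms are isomorphisms of Hodge structures;
Deligne, LNM 900, I §3.1: the tensor spaces `T^{a,b}` are functorial in isomorphisms).
1. Take `e : X^τ ≅ X` and `L := Hⁱ(e⁻¹) = ((B.W.H i).mapIso e.symm.op).toLinearEquiv :
   Hⁱ(X^τ) ≃ₗ[ℚ] Hⁱ(X)`. By `hodge_eq_comapEquiv_of_iso` (the tree's proof of stub (ii-c)), the
   Hodge structure on `Hⁱ(X^τ)` is the transport `(B.hodge hX i).comapEquiv L`; hence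
   (`HodgeStructure.tensorSpace_comapEquiv`, `HodgeStructure.comapEquiv_hodgeClasses`) its
   weight-`0` Hodge tensors in `T^{a,b}` are the `(T L)⁻¹`-images of those of `Hⁱ(X)`, where
   `T L = L^{⊗a} ⊗ ((L⁻¹)ᵀ)^{⊗b}`.
2. Put `ψ := (L⁻¹)_ℂ = L.symm.baseChange ℚ ℂ`. The comparison `𝒞` is natural:
   `T ψ (𝒞(c ⊗ t)) = 𝒞(c ⊗ (T L)⁻¹ t)` (`congr_tensorComparison_tmul`, checked on pure tensors
   with `piTensorBaseChange_tmul_tprod`, `dualBaseChange_tmul_tmul`; Deligne, Hodge II,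
   1.1.6–1.1.12), so `T ψ` maps the span of the `𝒞(1 ⊗ t)`, `t` a Hodge tensor of `Hⁱ(X)`, onto
   the span of the `𝒞(1 ⊗ t')`, `t' = (T L)⁻¹ t` a Hodge tensor of `Hⁱ(X^τ)`
   (`Submodule.map_span`).

Everything used is proved in the tree (`hodge_eq_comapEquiv_of_iso`, `tensorSpace_comapEquiv`,
`comapEquiv_hodgeClasses`, `IsSmoothProjective.conjugateVariety_holds`) or in Mathlib; no named
fact is assumed, no classicality of `B` is needed, and the weight condition `(a - b) i = 0` is not
used. No definition is introduced.

## References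

* [VoisinHodgeI2002] C. Voisin, Hodge Theory and Complex Algebraic Geometry I (2002), §7.3.2
  (functoriality of the Hodge structure on cohomology).
* [Deligne1982HodgeCycles] P. Deligne, Hodge cycles on abelian varieties, in LNM 900 (1982), I §3.1
  (the tensor spaces `T^{a,b}` and their functoriality), I 2.9.
* [DeligneHodgeII1971] P. Deligne, Théorie de Hodge II, Publ. Math. IHÉS 40 (1971), 1.1.6–1.1.12
  (duals and tensor products, compatibly with extension of scalars).
-/

noncomputable section

-- every declaration of this problem lives in `Summit.HodgeConjecture.HodgeConjecture.…` (summit = sub-problem)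
set_option linter.dupNamespace false

open scoped TensorProduct PiTensorProduct
open CategoryTheory Opposite
open Literature.AlgebraicGeometry.Motives

namespace Summit.HodgeConjecture.HodgeConjecture.Theorems

/-! ### Transport of the comparison map `𝒞` along a rational linear equivalence -/

section Transport

universe u

variable {V W : Type u} [AddCommGroup V] [Module ℚ V] [AddCommGroup W] [Module ℚ W]

/-- The complexification `(L⁻¹)_ℂ` of a rational linear equivalence maps rational vectors to
rational vectors: `(L⁻¹)_ℂ (1 ⊗ v) = 1 ⊗ L⁻¹ v`. [folklore] -/
theorem symm_baseChange_ofRat (L : W ≃ₗ[ℚ] V) (v : V) :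
    L.symm.baseChange ℚ ℂ V W (HodgeStructure.ofRat v) = HodgeStructure.ofRat (L.symm v) := rfl

/-- The contragredient `((L⁻¹)_ℂ⁻¹)ᵀ = (L_ℂ)ᵀ` of the complexified equivalence carries the
complexified rational form `1 ⊗ φ` (read in `(ℂ ⊗ V)^∨` through `dualBaseChange`) to the
complexified rational form `1 ⊗ (φ ∘ L)`: `⟨1 ⊗ φ, L_ℂ y⟩ = ⟨1 ⊗ (φ ∘ L), y⟩` (naturality of
`dualBaseChange`, as the tree's `dualBaseChange_symm_dualMap_baseChange`). [folklore] -/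
theorem symm_dualMap_dualBaseChange_ofRat (L : W ≃ₗ[ℚ] V) (φ : Module.Dual ℚ V) :
    (L.symm.baseChange ℚ ℂ V W).symm.dualMap
        (HodgeStructure.dualBaseChange V (HodgeStructure.ofRat φ)) =
      HodgeStructure.dualBaseChange W (HodgeStructure.ofRat (L.dualMap φ)) := by
  refine LinearMap.ext fun y => ?_
  induction y using TensorProduct.induction_on with
  | zero => simp only [map_zero]
  | add y₁ y₂ h₁ h₂ => simp only [map_add, h₁, h₂]
  | tmul d w =>
    simp [HodgeStructure.ofRat_apply, LinearEquiv.dualMap_apply, LinearEquiv.baseChange_symm_tmul,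
      HodgeStructure.dualBaseChange_tmul_tmul]

/-- **Transport of the comparison `𝒞` along a rational linear equivalence** `L : W ≃ V`: with
`ψ := (L⁻¹)_ℂ : ℂ ⊗ V ≃ ℂ ⊗ W`, its tensor functoriality `T ψ = ψ^{⊗a} ⊗ ((ψ⁻¹)ᵀ)^{⊗b}` and the
rational tensor functoriality `T L = L^{⊗a} ⊗ ((L⁻¹)ᵀ)^{⊗b} : T^{a,b} W ≃ T^{a,b} V`, one has
`T ψ (𝒞_V (c ⊗ t)) = 𝒞_W (c ⊗ (T L)⁻¹ t)` for `t ∈ T^{a,b} V`, where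
`𝒞 = (piTensorBaseChange ⊗ ((dualBaseChange)^{⊗b} ∘ piTensorBaseChange)) ∘ tensorBaseChange :
ℂ ⊗ T^{a,b} → (ℂ ⊗ -)^{⊗a} ⊗ ((ℂ ⊗ -)^∨)^{⊗b}` is the comparison map of the tree's tensor
constructions (Deligne, Hodge II, 1.1.6–1.1.12: duals and tensor products commute with extension
of scalars, naturally). Checked on pure tensors `t = (⊗ᵢ vᵢ) ⊗ (⊗ⱼ φⱼ)`, where both sides are
`c • (⊗ᵢ 1 ⊗ L⁻¹ vᵢ) ⊗ (⊗ⱼ dualBaseChange (1 ⊗ φⱼ ∘ L))` (`symm_baseChange_ofRat`,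
`symm_dualMap_dualBaseChange_ofRat`). [cite: DeligneHodgeII1971, 1.1.6–1.1.12] -/
theorem congr_tensorComparison_tmul (L : W ≃ₗ[ℚ] V) (a b : ℕ) (c : ℂ)
    (t : hodgeTensorSpace V a b) :
    TensorProduct.congr (PiTensorProduct.congr fun _ : Fin a => L.symm.baseChange ℚ ℂ V W)
        (PiTensorProduct.congr fun _ : Fin b => (L.symm.baseChange ℚ ℂ V W).symm.dualMap)
      (((TensorProduct.map (HodgeStructure.piTensorBaseChange V (Fin a))
          ((PiTensorProduct.map fun _ : Fin b => HodgeStructure.dualBaseChange V) ∘ₗ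
            HodgeStructure.piTensorBaseChange (Module.Dual ℚ V) (Fin b))) ∘ₗ
        (HodgeStructure.tensorBaseChange (⨂[ℚ]^a V) (⨂[ℚ]^b (Module.Dual ℚ V))).toLinearMap)
        (c ⊗ₜ[ℚ] t)) =
    ((TensorProduct.map (HodgeStructure.piTensorBaseChange W (Fin a))
        ((PiTensorProduct.map fun _ : Fin b => HodgeStructure.dualBaseChange W) ∘ₗ
          HodgeStructure.piTensorBaseChange (Module.Dual ℚ W) (Fin b))) ∘ₗ
      (HodgeStructure.tensorBaseChange (⨂[ℚ]^a W) (⨂[ℚ]^b (Module.Dual ℚ W))).toLinearMap)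
      (c ⊗ₜ[ℚ] (TensorProduct.congr (PiTensorProduct.congr fun _ : Fin a => L)
        (PiTensorProduct.congr fun _ : Fin b => L.symm.dualMap)).symm t) := by
  induction t using TensorProduct.induction_on generalizing c with
  | zero => simp only [TensorProduct.tmul_zero, map_zero]
  | add x y hx hy => simp only [TensorProduct.tmul_add, map_add, hx, hy]
  | tmul x ξ =>
    induction x using PiTensorProduct.induction_on generalizing c with
    | add x y hx hy => simp only [TensorProduct.add_tmul, TensorProduct.tmul_add, map_add, hx, hy]
    | smul_tprod r v =>
      induction ξ using PiTensorProduct.induction_on generalizing c with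
      | add x y hx hy => simp only [TensorProduct.tmul_add, map_add, hx, hy]
      | smul_tprod s φ =>
        -- move the rational scalars onto `c`, then compute both sides on the pure tensor
        rw [TensorProduct.smul_tmul_smul, map_smul, ← TensorProduct.smul_tmul,
          ← TensorProduct.smul_tmul]
        simp only [LinearMap.coe_comp, Function.comp_apply, LinearEquiv.coe_coe,
          TensorProduct.congr_symm_tmul, PiTensorProduct.congr_symm_tprod,
          LinearEquiv.dualMap_symm, LinearEquiv.symm_symm, HodgeStructure.tensorBaseChange_tmul,
          TensorProduct.map_tmul, HodgeStructure.piTensorBaseChange_tmul_tprod, one_smul,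
          PiTensorProduct.map_tprod, map_smul, TensorProduct.congr_tmul,
          PiTensorProduct.congr_tprod, symm_baseChange_ofRat, symm_dualMap_dualBaseChange_ofRat]

end Transport

/-- STUB S3 of the line skeleton `Cruxes/QbarGenericIsHodgeGeneric/Lines/birth.lean` (reshape r6),
PROVED — **the conjugate comparison matching Hodge tensors exists whenever `X^τ ≅ X` over `ℂ`.**
For an isomorphism `e : X^τ ≅ X`, the Hodge structure on `Hⁱ(X^τ)` is the transport of that on
`Hⁱ(X)` along `L := Hⁱ(e⁻¹) : Hⁱ(X^τ) ≃ₗ[ℚ] Hⁱ(X)` (`hodge_eq_comapEquiv_of_iso`; Voisin I,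
§7.3.2), so the weight-`0` Hodge tensors of `Hⁱ(X^τ)` are the `(T L)⁻¹`-images of those of
`Hⁱ(X)` (`HodgeStructure.tensorSpace_comapEquiv`, `HodgeStructure.comapEquiv_hodgeClasses`;
Deligne, LNM 900, I §3.1), and `ψ := (L⁻¹)_ℂ` works: its tensor functoriality intertwines the
comparison maps, `T ψ (𝒞(1 ⊗ t)) = 𝒞(1 ⊗ (T L)⁻¹ t)` (`congr_tensorComparison_tmul`). The weight
condition `(a - b) i = 0` is not used and no classicality of `B` is needed.
[cite: VoisinHodgeI2002, §7.3.2] [cite: Deligne1982HodgeCycles, I §3.1] -/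
theorem stub_conjugateComparison_of_nonempty_iso :
    ∀ (B : BettiHodgeData ℂ) [HodgeTensorFacts.{0, 0}] (τ : ℂ ≃+* ℂ) ⦃n : ℕ⦄ ⦃X : SchemeOver ℂ⦄ (hX : IsSmoothProjective n X) (i : ℕ) [Module.Finite ℚ (B.W.obj X i)] [Module.Finite ℚ (B.W.obj (conjugateVariety τ X) i)], Nonempty (conjugateVariety τ X ≅ X) → ∃ ψ : ℂ ⊗[ℚ] B.W.obj X i ≃ₗ[ℂ] ℂ ⊗[ℚ] B.W.obj (conjugateVariety τ X) i, ∀ a b : ℕ, ((a : ℤ) - b) * ((i : ℤ)) = 0 → Submodule.map (TensorProduct.congr (PiTensorProduct.congr fun _ : Fin a => ψ) (PiTensorProduct.congr fun _ : Fin b => ψ.symm.dualMap)).toLinearMap (Submodule.span ℂ ((fun t => ((TensorProduct.map (HodgeStructure.piTensorBaseChange (B.W.obj X i) (Fin a)) ((PiTensorProduct.map fun _ : Fin b => HodgeStructure.dualBaseChange (B.W.obj X i)) ∘ₗ HodgeStructure.piTensorBaseChange (Module.Dual ℚ (B.W.obj X i)) (Fin b))) ∘ₗ (HodgeStructure.tensorBaseChange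 (⨂[ℚ]^a (B.W.obj X i)) (⨂[ℚ]^b (Module.Dual ℚ (B.W.obj X i)))).toLinearMap) ((1 : ℂ) ⊗ₜ[ℚ] t)) '' (((B.hodge hX i).tensorSpace a b).hodgeClasses 0 : Set (hodgeTensorSpace (B.W.obj X i) a b)))) = (Submodule.span ℂ ((fun t => ((TensorProduct.map (HodgeStructure.piTensorBaseChange (B.W.obj (conjugateVariety τ X) i) (Fin a)) ((PiTensorProduct.map fun _ : Fin b => HodgeStructure.dualBaseChange (B.W.obj (conjugateVariety τ X) i)) ∘ₗ HodgeStructure.piTensorBaseChange (Module.Dual ℚ (B.W.obj (conjugateVariety τ X) i)) (Fin b))) ∘ₗ (HodgeStructure.tensorBaseChange (⨂[ℚ]^a (B.W.obj (conjugateVariety τ X) i)) (⨂[ℚ]^b (Module.Dual ℚ (B.W.obj (conjugateVariety τ X) i)))).toLinearMap) ((1 : ℂ) ⊗ₜ[ℚ] t)) '' (((B.hodge (IsSmoothProjective.conjugateVariety_holds τ hX) i).tensorSpace a b).hodgeClasses 0 : Set (hodgeTensorSpace (B.W.obj (conjugateVariety τ X) i) a b)))) := by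
  intro B _ τ n X hX i _ _ hiso
  obtain ⟨e⟩ := hiso
  -- `L := Hⁱ(e⁻¹) = ((B.W.H i).mapIso e.symm.op).toLinearEquiv : Hⁱ(X^τ) ≃ₗ[ℚ] Hⁱ(X)` and
  -- `ψ := (L⁻¹)_ℂ = Hⁱ(e)_ℂ : ℂ ⊗ Hⁱ(X) ≃ₗ[ℂ] ℂ ⊗ Hⁱ(X^τ)`
  refine ⟨((B.W.H i).mapIso e.symm.op).toLinearEquiv.symm.baseChange ℚ ℂ _ _, fun a b _ => ?_⟩
  -- the Hodge structure on `Hⁱ(X^τ)` is the transport of that on `Hⁱ(X)` along `L`, so its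
  -- weight-`0` Hodge tensors are the `(T L)⁻¹`-images of those of `Hⁱ(X)`
  rw [hodge_eq_comapEquiv_of_iso B e (IsSmoothProjective.conjugateVariety_holds τ hX) hX i,
    HodgeStructure.tensorSpace_comapEquiv, HodgeStructure.comapEquiv_hodgeClasses,
    Submodule.comap_equiv_eq_map_symm, Submodule.map_coe, Submodule.map_span, Set.image_image,
    Set.image_image, LinearEquiv.coe_coe, LinearEquiv.coe_coe]
  -- and `T ψ ∘ 𝒞 ∘ (1 ⊗ -) = 𝒞 ∘ (1 ⊗ -) ∘ (T L)⁻¹` pointwise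
  exact congrArg _ (Set.image_congr' fun t => congr_tensorComparison_tmul _ a b 1 t)

end Summit.HodgeConjecture.HodgeConjecture.Theorems

end
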